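import Mathlib
import Summits.NavierStokesRegularity.NavierStokesRegularity.Theorems.TaoLadderRungTwoBreakBlowupRigidityOneUpperClock
import Summits.NavierStokesRegularity.NavierStokesRegularity.Theorems.TaoLadderRungTwoBreakBlowupRigidityOneCriticalRate
import HarnessLib

/-!
# THE SUB-UNITARY CLOCK of an exact cascade blow-up: when shell `n+1` first lights, the blow-up is still
  `T⋆ - s_{n+1} ≥ Λ^{-n}/(C_r √E₀)` away (`σ_{n+1} ≤ n·log Λ + log(C_r √E₀)` in log-time: the front's delay per shell is
  at most `log Λ`, i.e. its per-shell energy ratio is at most `1`) — support for `stub_eternalFromBlowup` of K2(1)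
  `TaoLadderRungTwoBreak.BlowupRigidityOne` (stmt-NavierStokesRegularity-20206)

MODEL lattice ODEs only (Tao 2016 §4 (4.3), Lemma 4.1 (4.5)–(4.10), (4.12), §6.4); nothing here is a statement about the
Navier–Stokes equations; NO item is closed (`--supports stmt-NavierStokesRegularity-20206`). General `m`; DEF-FREE.

Two tree facts are played against each other at a time `s` when every shell above `n` is UNLIT
(`C_A T Λ^{j+1}‖x_j(s)‖ < 1/2` for `j > n`, e.g. any `s` before the first-lit time of shell `n+1`, by ORDERED IGNITION):
the blow-up rate is at least type I (`critical_rate_lower_bound`: `sup_k Λ^k|X_{i,k}(s)| ≥ 1/(C_r (T-s))`), while the lit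
region `k ≤ n` carries at most the datum energy (`Λ^k‖x_k(s)‖ ≤ Λ^n √E₀`). Hence
`1 ≤ C_r (T - s) · max(Λ^n √E₀, (2 C_A T Λ)⁻¹)`:
* `unlit_above_of_unlit` — ordered ignition upward: if shell `n+1` is unlit on `[0,r)`, so is every shell `j ≥ n+1`;
* `remainingTime_ge_of_unlit_above` — the displayed inequality at a time `s` with all shells above `n` unlit;
* `subunitaryClock` — if shell `n+1` is unlit on `[0,r)` (`0 ≤ r ≤ T`), then `1 ≤ C_r (T - r) max(Λ^n √E₀, (2 C_A T Λ)⁻¹)`;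
  for `Λ^n √E₀ ≥ (2C_A T Λ)⁻¹` this is `T - s_{n+1} ≥ Λ^{-n}/(C_r √E₀)`, against the `Λ^{-2n}` of
  `remainingTime_lower_bound` — the physical-time form of SUB-UNITARITY of the front (a DSS front with per-shell
  energy ratio `μ = e^{2T'}/Λ²` has `σ_n ≈ n T'`, and `T' ≤ log Λ` iff `μ ≤ 1`);
* `subunitaryClock_of_noGlobalCascade` — the package along the maximal exact flow of every robust blow-up of a table
  `α ∈ E₂(R)` (`C_r = m²(3+Λ)` from `criticalRate_of_noGlobalCascade`).

HONEST LABEL. An unconditional ONE-SIDED clock (upper bound on the log-time schedule); the front bundle of the stub needs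
the OTHER side (`σ_n ≥ n log(Λν) - C` with `ν² ≥ (1+ε₀)⁻¹`, i.e. the surviving LOWER clock) together with the a = 1 floor;
`stub_eternalIsDSS` untouched. No stub, crux or summit is proved; rung 0.
-/

noncomputable section

-- the summit and its single sub-problem share the name (CONVENTIONS §1)
set_option linter.dupNamespace false

open Set Filter Topology MeasureTheory intervalIntegral

namespace Summit.NavierStokesRegularity.NavierStokesRegularity.Theorems

namespace BlowupRigidityOne

open Literature.Analysis.FluidPDE Literature.Analysis.FluidPDE.TaoCascade

variable {m : ℕ}

/-- **Ordered ignition, upward**: if shell `n+1` is unlit on `[0,r)`, then every shell `j ≥ n+1` is unlit on `[0,r)`.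
[cite: Tao2016AveragedNS, §4 (4.3), Lemma 4.1 (4.8)–(4.10); §1.2] -/
theorem unlit_above_of_unlit {ε₀ T : ℝ} (hε : 0 < ε₀) (hT : 0 < T)
    {α : Fin m → Fin m → Fin m → ℤ × ℤ × ℤ → ℝ} (hc : IsCancellingCoeff α)
    {X : Fin m → ℤ → ℝ → ℝ} {X₀ : Fin m → ℝ}
    (hder : ∀ i k, ∀ t ∈ Ico 0 T, HasDerivWithinAt (X i k) (quadTerm ε₀ α X i k t) (Ici 0) t)
    (hinit : ∀ i k, X i k 0 = if k = 0 then X₀ i else 0)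
    (hlow : ∀ i k t, k < 0 → X i k t = 0)
    (hreg : ∀ T' : ℝ, T' < T → ∃ M : ℝ, ∀ t ∈ Icc 0 T', ∀ (i : Fin m) (k : ℤ),
      (1 + (1 + ε₀) ^ ((10 : ℝ) * k)) * |X i k t| ≤ M)
    (n : ℕ) {r : ℝ} (hrT : r ≤ T)
    (hunlit : ∀ s ∈ Ico 0 r, fluxConst α * T * bigLam ε₀ ^ (n + 1 + 1) * ‖shellVec X ((n + 1 : ℕ) : ℤ) s‖ < 1 / 2) :
    ∀ j : ℕ, n < j → ∀ s ∈ Ico 0 r, fluxConst α * T * bigLam ε₀ ^ (j + 1) * ‖shellVec X (j : ℤ) s‖ < 1 / 2 := by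
  intro j hj
  induction j with
  | zero => exact absurd hj (Nat.not_lt_zero _)
  | succ j ih =>
    rcases Nat.lt_succ_iff_lt_or_eq.1 hj with h | h
    · -- `n < j`: shell `j` unlit on `[0,r)` by induction; shell `j+1` lit at `s < r` would light shell `j` earlier
      intro s hs
      by_contra hcon
      push Not at hcon
      obtain ⟨r', hr', hlit'⟩ := orderedIgnition hε hT hc hder hinit hlow hreg j ⟨hs.1, lt_of_lt_of_le hs.2 hrT⟩ hcon
      exact absurd (ih h r' ⟨hr'.1, lt_of_le_of_lt hr'.2 hs.2⟩) (not_lt.2 hlit')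
    · subst h; exact hunlit

/-- **Rate versus energy at a time when the shells above `n` are unlit**: `1 ≤ C_r (T-s) · max(Λ^n √E₀, (2 C_A T Λ)⁻¹)`,
given the type-I rate lower bound with constant `C_r` (`critical_rate_lower_bound`) and the energy bound on the lit shells.
[cite: Tao2016AveragedNS, §4 (4.3), Lemma 4.1 (4.5), (4.8)–(4.10), (4.12), §6.4; Teschl2012, §2.6] -/
theorem remainingTime_ge_of_unlit_above {ε₀ T Cr : ℝ} (hε : 0 < ε₀) (hT : 0 < T)
    {α : Fin m → Fin m → Fin m → ℤ × ℤ × ℤ → ℝ} (hc : IsCancellingCoeff α)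
    {X : Fin m → ℤ → ℝ → ℝ} {X₀ : Fin m → ℝ}
    (hder : ∀ i k, ∀ t ∈ Ico 0 T, HasDerivWithinAt (X i k) (quadTerm ε₀ α X i k t) (Ici 0) t)
    (hinit : ∀ i k, X i k 0 = if k = 0 then X₀ i else 0)
    (hlow : ∀ i k t, k < 0 → X i k t = 0)
    (hreg : ∀ T' : ℝ, T' < T → ∃ M : ℝ, ∀ t ∈ Icc 0 T', ∀ (i : Fin m) (k : ℤ),
      (1 + (1 + ε₀) ^ ((10 : ℝ) * k)) * |X i k t| ≤ M)
    (hrate : ∀ s ∈ Ico (0 : ℝ) T, ∀ L : ℝ, L * (Cr * (T - s)) < 1 →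
      ∃ (i : Fin m) (k : ℤ), L < (1 + ε₀) ^ ((5 : ℝ) * k / 2) * |X i k s|)
    (n : ℕ) {s : ℝ} (hs : s ∈ Ico 0 T)
    (hun : ∀ j : ℕ, n < j → fluxConst α * T * bigLam ε₀ ^ (j + 1) * ‖shellVec X (j : ℤ) s‖ < 1 / 2) :
    1 ≤ Cr * (T - s) * max (bigLam ε₀ ^ n * Real.sqrt (∑ i, X₀ i ^ 2)) (2 * fluxConst α * T * bigLam ε₀)⁻¹ := by
  have hb : (0 : ℝ) < 1 + ε₀ := by linarith
  have hL : 0 < bigLam ε₀ := bigLam_pos (by linarith)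
  have hL1 : 1 ≤ bigLam ε₀ := (Real.one_lt_rpow (by linarith) (by norm_num) : 1 < bigLam ε₀).le
  have hCA : 0 ≤ fluxConst α := fluxConst_nonneg α
  set D : ℝ := Real.sqrt (∑ i, X₀ i ^ 2) with hD
  have hD0 : 0 ≤ D := Real.sqrt_nonneg _
  set B : ℝ := max (bigLam ε₀ ^ n * D) (2 * fluxConst α * T * bigLam ε₀)⁻¹ with hB
  have hB0 : 0 ≤ B := le_max_of_le_left (by positivity)
  -- every critical amplitude at time `s` is `≤ B`
  have hbound : ∀ (i : Fin m) (k : ℤ), (1 + ε₀) ^ ((5 : ℝ) * k / 2) * |X i k s| ≤ B := by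
    intro i k
    rcases lt_or_ge k 0 with hk | hk
    · rw [hlow i k s hk, abs_zero, mul_zero]; exact hB0
    · obtain ⟨k', rfl⟩ := Int.eq_ofNat_of_zero_le hk
      have hcomp : |X i (k' : ℤ) s| ≤ ‖shellVec X (k' : ℤ) s‖ := by
        simpa [shellVec_apply, Real.norm_eq_abs] using PiLp.norm_apply_le (shellVec X (k' : ℤ) s) i
      rw [DSSOneShift.bigLam_zpow_eq_rpow hb (k' : ℤ), zpow_natCast]
      refine (mul_le_mul_of_nonneg_left hcomp (pow_nonneg hL.le _)).trans ?_
      rcases le_or_gt k' n with hkn | hkn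
      · -- lit region: energy bound
        have hE := norm_shellVec_le_sqrt_datumEnergy hε hc hder hinit hlow hreg (k' : ℤ) s hs
        calc bigLam ε₀ ^ k' * ‖shellVec X (k' : ℤ) s‖ ≤ bigLam ε₀ ^ n * D :=
              mul_le_mul (pow_le_pow_right₀ hL1 hkn) hE (norm_nonneg _) (pow_nonneg hL.le _)
          _ ≤ B := le_max_left _ _
      · -- unlit region
        have h := hun k' hkn
        rcases hCA.eq_or_lt with h0 | hpos
        · -- `C_A = 0`: shells above `0` vanish (no emission); here `k' ≥ 1`
          obtain ⟨k'', rfl⟩ : ∃ k'', k' = k'' + 1 := ⟨k' - 1, by omega⟩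
          have h1 := norm_succ_le_action_sq hε hc hder hinit hlow hreg k'' s hs
          rw [← h0, zero_mul, zero_mul] at h1
          have hcast : (((k'' + 1 : ℕ) : ℤ)) = ((k'' : ℕ) : ℤ) + 1 := by push_cast; ring
          rw [hcast, le_antisymm h1 (norm_nonneg _), mul_zero]
          exact hB0
        · have hq : 0 < 2 * fluxConst α * T * bigLam ε₀ := by positivity
          calc bigLam ε₀ ^ k' * ‖shellVec X (k' : ℤ) s‖
              = (fluxConst α * T * bigLam ε₀ ^ (k' + 1) * ‖shellVec X (k' : ℤ) s‖) * (fluxConst α * T * bigLam ε₀)⁻¹ := by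
                field_simp
                ring
            _ ≤ (1 / 2) * (fluxConst α * T * bigLam ε₀)⁻¹ :=
                mul_le_mul_of_nonneg_right h.le (inv_nonneg.2 (by positivity))
            _ = (2 * fluxConst α * T * bigLam ε₀)⁻¹ := by field_simp
            _ ≤ B := le_max_right _ _
  -- the rate bound: every `L < 1/(C_r (T-s))` is `< B`, hence `1/(C_r(T-s)) ≤ B`
  have hTs : 0 < T - s := by linarith [hs.2]
  by_contra hcon
  push Not at hcon
  -- `C_r (T-s) B < 1`: take `L = B`
  have hLB : B * (Cr * (T - s)) < 1 := by nlinarith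
  obtain ⟨i, k, hlt⟩ := hrate s hs B hLB
  exact absurd (hbound i k) (not_le.2 hlt)

/-- **THE SUB-UNITARY CLOCK.** If shell `n+1` is unlit on `[0,r)` (`0 ≤ r ≤ T`), then
`1 ≤ C_r (T - r) · max(Λ^n √E₀, (2 C_A T Λ)⁻¹)`; in particular `T - s_{n+1} ≥ Λ^{-n}/(C_r √E₀)` as soon as
`Λ^n √E₀ ≥ (2 C_A T Λ)⁻¹`, i.e. `σ_{n+1} ≤ n log Λ + log(C_r √E₀)` at the first-lit log-times.
[cite: Tao2016AveragedNS, §4 (4.3), Lemma 4.1 (4.5), (4.8)–(4.10), (4.12), §6.4; Teschl2012, §2.6] -/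
theorem subunitaryClock {ε₀ T Cr : ℝ} (hε : 0 < ε₀) (hT : 0 < T)
    {α : Fin m → Fin m → Fin m → ℤ × ℤ × ℤ → ℝ} (hc : IsCancellingCoeff α)
    {X : Fin m → ℤ → ℝ → ℝ} {X₀ : Fin m → ℝ}
    (hder : ∀ i k, ∀ t ∈ Ico 0 T, HasDerivWithinAt (X i k) (quadTerm ε₀ α X i k t) (Ici 0) t)
    (hinit : ∀ i k, X i k 0 = if k = 0 then X₀ i else 0)
    (hlow : ∀ i k t, k < 0 → X i k t = 0)
    (hreg : ∀ T' : ℝ, T' < T → ∃ M : ℝ, ∀ t ∈ Icc 0 T', ∀ (i : Fin m) (k : ℤ),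
      (1 + (1 + ε₀) ^ ((10 : ℝ) * k)) * |X i k t| ≤ M)
    (hCr : 0 < Cr)
    (hrate : ∀ s ∈ Ico (0 : ℝ) T, ∀ L : ℝ, L * (Cr * (T - s)) < 1 →
      ∃ (i : Fin m) (k : ℤ), L < (1 + ε₀) ^ ((5 : ℝ) * k / 2) * |X i k s|)
    (n : ℕ) {r : ℝ} (hr0 : 0 ≤ r) (hrT : r ≤ T)
    (hunlit : ∀ s ∈ Ico 0 r, fluxConst α * T * bigLam ε₀ ^ (n + 1 + 1) * ‖shellVec X ((n + 1 : ℕ) : ℤ) s‖ < 1 / 2) :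
    1 ≤ Cr * (T - r) * max (bigLam ε₀ ^ n * Real.sqrt (∑ i, X₀ i ^ 2)) (2 * fluxConst α * T * bigLam ε₀)⁻¹ := by
  have hL : 0 < bigLam ε₀ := bigLam_pos (by linarith)
  have hCA : 0 ≤ fluxConst α := fluxConst_nonneg α
  set B : ℝ := max (bigLam ε₀ ^ n * Real.sqrt (∑ i, X₀ i ^ 2)) (2 * fluxConst α * T * bigLam ε₀)⁻¹ with hB
  have hB0 : 0 ≤ B := le_max_of_le_left (by positivity)
  have hup := unlit_above_of_unlit hε hT hc hder hinit hlow hreg n hrT hunlit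
  -- the bound at every `s ∈ [0,r)`
  have key : ∀ s ∈ Ico (0:ℝ) r, 1 ≤ Cr * (T - s) * B := fun s hs =>
    remainingTime_ge_of_unlit_above hε hT hc hder hinit hlow hreg hrate n ⟨hs.1, lt_of_lt_of_le hs.2 hrT⟩
      fun j hj => hup j hj s hs
  rcases eq_or_lt_of_le hr0 with h0 | h0
  · -- `r = 0`: all shells `j ≥ 1` vanish at time `0`, so the bound holds at `s = 0` directly
    subst h0
    have h00 : (0:ℝ) ∈ Ico 0 T := ⟨le_rfl, hT⟩
    exact remainingTime_ge_of_unlit_above hε hT hc hder hinit hlow hreg hrate n h00 fun j hj => by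
      have hz : shellVec X (j : ℤ) 0 = 0 := by
        ext i
        rw [shellVec_apply, hinit]
        have hj0 : j ≠ 0 := by omega
        simp [hj0]
      rw [hz, norm_zero, mul_zero]; norm_num
  · -- `r > 0`: approximate `r` from below
    by_contra hcon
    push Not at hcon
    -- choose `s = r - δ` with `C_r δ B < 1 - C_r (T-r) B`
    have hgap : 0 < 1 - Cr * (T - r) * B := by linarith
    obtain ⟨δ, hδ0, hδr, hδB⟩ : ∃ δ : ℝ, 0 < δ ∧ δ ≤ r ∧ Cr * δ * B < 1 - Cr * (T - r) * B := by
      rcases eq_or_lt_of_le hB0 with hB00 | hBpos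
      · exact ⟨r, h0, le_rfl, by rw [← hB00]; simp⟩
      · refine ⟨min r ((1 - Cr * (T - r) * B) / (2 * Cr * B)), lt_min h0 (by positivity), min_le_left _ _, ?_⟩
        have h1 : min r ((1 - Cr * (T - r) * B) / (2 * Cr * B)) ≤ (1 - Cr * (T - r) * B) / (2 * Cr * B) :=
          min_le_right _ _
        have h2 : Cr * ((1 - Cr * (T - r) * B) / (2 * Cr * B)) * B = (1 - Cr * (T - r) * B) / 2 := by
          field_simp
        calc Cr * min r ((1 - Cr * (T - r) * B) / (2 * Cr * B)) * B
            ≤ Cr * ((1 - Cr * (T - r) * B) / (2 * Cr * B)) * B :=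
              mul_le_mul_of_nonneg_right (mul_le_mul_of_nonneg_left h1 hCr.le) hB0
          _ = (1 - Cr * (T - r) * B) / 2 := h2
          _ < 1 - Cr * (T - r) * B := by linarith
    have hs : r - δ ∈ Ico (0:ℝ) r := ⟨by linarith, by linarith⟩
    have h := key (r - δ) hs
    have : Cr * (T - (r - δ)) * B = Cr * (T - r) * B + Cr * δ * B := by ring
    linarith

/-! ### Along a robust blow-up -/

/-- **THE SUB-UNITARY CLOCK ALONG A ROBUST BLOW-UP.** If `NoGlobalCascade ε₀ α X₀` (`ε₀ > 0`, `α ∈ E₂(R)`, any `m`),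
then along the maximal exact cascade flow `X` from the one-shell datum on `[0,T⋆)`: whenever shell `n+1` is unlit on
`[0,r)` (`C_A T⋆ Λ^{n+2}‖x_{n+1}(s)‖ < 1/2` for `0 ≤ s < r`, `0 ≤ r ≤ T⋆`),
`1 ≤ m²(3+Λ) (T⋆ - r) · max(Λ^n √E₀, (2 C_A T⋆ Λ)⁻¹)` — the first-lit schedule obeys `σ_{n+1} ≤ n log Λ + log(m²(3+Λ)√E₀)`
for all large `n`.
[cite: Tao2016AveragedNS, §4 Thm. 4.2 (statement shape), (4.3), Lemma 4.1 (4.5), (4.8)–(4.10), (4.12), §6.4; Teschl2012, §2.6] -/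
theorem subunitaryClock_of_noGlobalCascade {ε₀ R : ℝ} (hε : 0 < ε₀)
    {α : Fin m → Fin m → Fin m → ℤ × ℤ × ℤ → ℝ} {X₀ : Fin m → ℝ} (hα : InTableClass R α)
    (hNG : NoGlobalCascade ε₀ α X₀) :
    ∃ (T : ℝ) (X : Fin m → ℤ → ℝ → ℝ), 0 < T ∧
      (∀ i n, ContDiffOn ℝ 1 (X i n) (Set.Ico 0 T)) ∧
      (∀ i n, X i n 0 = if n = 0 then X₀ i else 0) ∧
      (∀ i n t, n < 0 → X i n t = 0) ∧
      (∀ i n t, 0 ≤ t → t < T → derivWithin (X i n) (Set.Ici 0) t = quadTerm ε₀ α X i n t) ∧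
      (∀ T' : ℝ, 0 < T' → T' < T → ∃ M : ℝ, ∀ t : ℝ, 0 ≤ t → t ≤ T' →
        ∀ (i : Fin m) (n : ℤ), (1 + (1 + ε₀) ^ ((10 : ℝ) * n)) * |X i n t| ≤ M) ∧
      (∀ (n : ℕ) (r : ℝ), 0 ≤ r → r ≤ T →
        (∀ s ∈ Ico (0:ℝ) r, fluxConst α * T * bigLam ε₀ ^ (n + 1 + 1) * ‖shellVec X ((n + 1 : ℕ) : ℤ) s‖ < 1 / 2) →
        1 ≤ (m : ℝ) ^ 2 * (3 + bigLam ε₀) * (T - r) *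
          max (bigLam ε₀ ^ n * Real.sqrt (∑ i, X₀ i ^ 2)) (2 * fluxConst α * T * bigLam ε₀)⁻¹) := by
  obtain ⟨T, X, hT, h1, h2, h3, h4, h5, h6⟩ := criticalRate_of_noGlobalCascade hε hα hNG
  have hder : ∀ i k, ∀ τ ∈ Ico (0 : ℝ) T,
      HasDerivWithinAt (X i k) (quadTerm ε₀ α X i k τ) (Ici 0) τ := by
    intro i k τ hτ
    have hd : DifferentiableWithinAt ℝ (X i k) (Ico 0 T) τ :=
      ((h1 i k).differentiableOn one_ne_zero) τ hτ
    have hd' : DifferentiableWithinAt ℝ (X i k) (Ici 0) τ :=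
      hd.mono_of_mem_nhdsWithin (by
        rw [mem_nhdsWithin]
        exact ⟨Iio T, isOpen_Iio, hτ.2, fun x hx => ⟨hx.2, hx.1⟩⟩)
    rw [← h4 i k τ hτ.1 hτ.2]
    exact hd'.hasDerivWithinAt
  have hreg : ∀ T' : ℝ, T' < T → ∃ M : ℝ, ∀ τ ∈ Icc (0 : ℝ) T', ∀ (i : Fin m) (k : ℤ),
      (1 + (1 + ε₀) ^ ((10 : ℝ) * k)) * |X i k τ| ≤ M := by
    intro T' hT'
    rcases le_or_gt T' 0 with h0 | h0
    · obtain ⟨M, hM⟩ := h5 (T / 2) (by linarith) (by linarith)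
      exact ⟨M, fun τ hτ i k => hM τ hτ.1 (by linarith [hτ.2]) i k⟩
    · obtain ⟨M, hM⟩ := h5 T' h0 hT'
      exact ⟨M, fun τ hτ i k => hM τ hτ.1 hτ.2 i k⟩
  have hL : 0 < bigLam ε₀ := bigLam_pos (by linarith)
  -- `m ≥ 1` (a blow-up has a mode), so `C_r = m²(3+Λ) > 0`
  have hm : 0 < (m : ℝ) := by
    obtain ⟨t, ht, i, k, -⟩ : ∃ t ∈ Ico (0:ℝ) T, ∃ (i : Fin m) (k : ℤ), True := by
      obtain ⟨i, k, -⟩ := h6 0 ⟨le_rfl, hT⟩ 0 (by simp)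
      exact ⟨0, ⟨le_rfl, hT⟩, i, k, trivial⟩
    have : 0 < m := Fin.pos i
    exact_mod_cast this
  have hCr : 0 < (m : ℝ) ^ 2 * (3 + bigLam ε₀) := by positivity
  refine ⟨T, X, hT, h1, h2, h3, h4, h5, fun n r hr0 hrT hun => ?_⟩
  have h := subunitaryClock hε hT hα.2.1 hder h2 h3 hreg hCr (fun s hs L hL' => h6 s hs L hL') n hr0 hrT hun
  simpa [mul_assoc] using h

end BlowupRigidityOne

end Summit.NavierStokesRegularity.NavierStokesRegularity.Theorems

end
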